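/-
Copyright (c) 2026 the pub-hodgecm-mathlib formalisation cell (harness21).  Prover seat hodgecm-mathlib-LH4-p15 (g3), req620 Track A «(D-RAM) FOUR-FRAME» squad
((β₂) road (R-36), the K6 road — K6 DESK WORD #22 A5 «THE TOP CELL IDENTITY `htop`, BOTH PARITIES»: the A6 skeleton's fourth hole, from ★ A2-TOP p864968 `topCell_law_hyper∕aniso` (LH4-p18 (g4)), ★ §3
`cellValue_of_perCellLaw`, the class split ★ (d′1)∕(d′2), the `NX ↔ unit` letter of «A1-top» v2 and ★ (g-top) p864688; the top DENSITY enters as a LETTER), 2026-09-05.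
-/
import Summits.HodgeConjecture.HodgeConjecture.Theorems.F0P3cDyRamTopCellLawFrames             -- ★ A2-TOP p864968 (LH4-p18 (g4)): `topCell_law_hyper`, `topCell_law_aniso` (★ F1b-top p864859 on the top cell of the two frames)
import Summits.HodgeConjecture.HodgeConjecture.Theorems.F0P3cDyRamRamKFrameClassLetters         -- ★ p864373 (LH4-p19 (g3)): `deep_of_datum` (the `hdeep` letter at `r₀ := |jEϖ|^{2d−1}`)
import Summits.HodgeConjecture.HodgeConjecture.Theorems.F0P3cDyRamCoreOfPerCellLaws             -- ★ p864409∕p864591 (LH4-p16 (g3)) §3 `cellValue_of_perCellLaw` (law + density ⟹ solved value)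
import Summits.HodgeConjecture.HodgeConjecture.Theorems.F0P3cDyRamRowCellDigitClassSplit        -- ★ (d′1)∕(d′2) (LH7-p08 (g3)): `classClause_iff_not_classClause`, `classClause_or`, `classClause_of_far`
import Summits.HodgeConjecture.HodgeConjecture.Theorems.F0P3cDyRamRowCellDigitShellDictionary   -- ★ p864361 (LH7-p08 (g3)): `sphereClause_iff_v_eq_one_of_lt` (the sphere clause of a tower cell reads `|V| = 1`)
import Summits.HodgeConjecture.HodgeConjecture.Theorems.F0P3cDyRamTopSphereLabelSumVanishes     -- ★ (g-top) p864688 (LH4-p08 (g12)): `sum_normSign_affine_topSphere_eq_zero`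
import HarnessLib

/-!
# Crux `H413`, line LH4 «(D-RAM) FOUR-FRAME» — (β₂) road, the K6 road, A5: «THE TOP CELL IDENTITY» — in ‹CORE.letter.v1›'s ∕ ‹CORE-ODD.v1›'s TWO-frame letters (hyperbolic
# literal `(φ, h, f)` on `(StdForm.antidiagonal 2).over E`, anisotropic literal `(φ′, h′, f′)` on `Matrix.diagonal dg` with `formCongr σ P₁ Φ₃ = block(diagonal dg, η)`, `η ∉ N(E^×)`),
# the K6 floor, the live row `2b + d%2 = m` (BOTH parities), a window `m + 2N = jl` with `1 ≤ N`, the row's TOP chart («A1-top» v2, with BOTH unit letters), a top digit system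
# `Rd` mod `|ϖ|^n` (`2d − 1 ≤ n ≤ b`) and the top DENSITY as a letter: `X_H(b + 2N) = if N < d then X_A(b + 2N) else 0` — ★ (P1)'s `htop` bytes, the A6 skeleton's fourth hole

Cell `hodgecm-mathlib` (D-0151), FLOOR 0, crux item H413 = `stmt-HodgeConjecture-24833`, route of record `HCCMUnconditional`; squad F0∕P3c∕LH4; lane
`--supports stmt-HodgeConjecture-24833 --as helper` (count-neutral; pays NO tier-0 row).  THEOREMS ONLY (no `def`, no instance, no notation, no `sorry`, default heartbeats);
★-only imports; states NO law; ‹CORE›∕‹CORE-ODD›∕(β₂) stay HYPOTHESES of their consumers.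

WHAT (K6 DESK WORDS #17∕#19∕#22; the A6 skeleton `core_holds` 02:58:38Z: `★ (P1) coreWindow_of_insideWindow_and_topCell … hin htop`).  With `X_t(j) := Σᶠ_{cell_t(j) ∩ P_t} f_t −
Σᶠ_{cell_t(j) ∩ Q_t} f_t` the letters' per-literal cell values (the set-builders of ‹CORE.v1› at the two frames), the TOP cell `j = b + 2N` (`N = (jl − m)∕2 ≥ 1`) satisfies
**`X_H(b + 2N) = if N < d then X_A(b + 2N) else 0`**.  MECHANISM (all ★ but the density letter): per frame `t`, ★ A2-TOP p864968 `topCell_law_hyper` ∕ `topCell_law_aniso` (LH4-p18 (g4): ★ F1b-top p864859 with class∕floor∕cell letters discharged; its PRECISION letters discharged HERE, §0, at `r := |ϖ|^n`, `2d − 1 ≤ n ≤ b`, `r₀ := |jEϖ|^{2d−1}`, `hdeep` by ★ `deep_of_datum`) gives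
`X_t·#S_t = n_t·(ω(−h_W^t)·Σ_{S′_t} ω(α₁ + γ₁V))` on `S_t := Rd.filter LIT_t`, `S′_t := S_t.filter NX`; the DENSITY LETTER `n_t = φ·#S_t` (ONE `φ` for both frames — LH4-p08 (g12)'s
`…TopCellDensity.topCell_density`, plugged by the assembler; taken here as the hypotheses `hdensH`, `hdensA`) and ★ §3 `cellValue_of_perCellLaw` solve `X_t = φ·ω(−h_W^t)·Σ_{S′_t} ω`;
the SIGN `ω(−η) = −ω(−1)` (★ Lit `normSign_mul_eq_neg_of_not_norm`, `η ∉ N`); on the digit line the sphere clause of the top cell reads `|V| = 1` (★ `sphereClause_iff_v_eq_one_of_lt`,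
`|κ₀| = 1 < |ξ₀| = exp 2N`), `NX V ↔ |α₁ + γ₁V| = 1` («A1-top» v2's two unit letters `hαγ`, `hγα` — ★ `…AffineLabelOnShellIff`), and the classes split the sphere (★ (d′1)
`classClause_or`, `classClause_iff_not_classClause`) for `N < d`, resp. the sphere is ONE-class hyperbolic (★ (d′2) `classClause_of_far`, `exp(2d − 1) ≤ exp 2N`) for `d ≤ N`; so
`Σ_{S′_H} ω + Σ_{S′_A} ω` (`N < d`), resp. `Σ_{S′_H} ω` (`d ≤ N`), IS ★ (g-top) p864688's top-sphere sum `Σ_{|V| = 1 ∧ |α₁ + γ₁V| = 1} ω(α₁ + γ₁V) = 0` — LH4-p08's `htop_of_solved`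
arithmetic, inlined (`linear_combination`).
BINDERS: ‹CORE.v1›'s letters BY NAME for BOTH frames (`_hΓ`, `φ h f …`; `P₁ dg η γA _hA _hΓ' _hdg1 _hdgσ _hησ _hη1 _hηN`, `φ' h' f' …` — exactly ★ A2-TOP's frame letters + `hηN` for the
sign and the class split), the dyadic letter `h2`, the K6 floor at `N₀`
(`4d ≤ N₀ ≤ m`, `_hu1N`, `_hlam1`), the row `hbm`, the window `hN1 hNjl`, the TOP chart = «A1-top» v2's conjuncts BY NAME (`hκ₀ hΘκ₀ hκ₀v hξ hΘξ hξN hξv hμab hR₀ hγ₀ hα₁σ hα₁1 hγ₁σ hγ₁v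
hαγ hγα haff`), the top system `Rd` (`hn : 2d − 1 ≤ n`, `hnb : n ≤ b`, `hRd1 hRd2 hRd3`), the density letters `hdensH`, `hdensA` at a common `φ : ℤ`.
WHAT IS NOT CLAIMED: the density (LH4-p08), the sizes, the `N = 0` window (‹D0›, the parked corner: ★ F1b-top reads only `b < j`), the inside window (★ A2∕A3∕A4), any census identity.
HONEST LABEL.  Count-neutral assembly of ★ pieces; nothing printed is asserted; no census law is stated; `HC_CM` is proved only modulo the 7 printed citations (2 remaining named
inputs: hLiu418 = `stmt-HodgeConjecture-24832`, h413 = `stmt-HodgeConjecture-24833`) until rung 0 closes.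
## References
* [Kottwitz1986BaseChangeUnits] R. E. Kottwitz, *Base change for unit elements of Hecke algebras*, Compositio Math. 60 (1986): §1 pp. 240–241 (signed lattice counts cell by cell).
* [LabesseLanglands1979] J.-P. Labesse, R. P. Langlands, *L-indistinguishability for SL(2)*, Canad. J. Math. 31 (1979): §2 (2.2) p. 9 (κ-signed counts).
* [Rogawski1990] J. D. Rogawski, *Automorphic Representations of Unitary Groups in Three Variables*, Ann. of Math. Stud. 123 (1990): §4.9 Prop. 4.9.1 (b) p. 55.
* [Serre1979] J.-P. Serre, *Local Fields*, GTM 67 (1979): Ch. V §3 Prop. 5, Cor. 2–3 pp. 84–86; Ch. XV §2 (the conductor of the norm-residue sign); [Jacobowitz1962] §3.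
-/

set_option autoImplicit false

noncomputable section

namespace Summit.HodgeConjecture.HodgeConjecture.Cruxes.H413.F0P3cDyRamTopCellIdentity

open scoped Valued WithZero Matrix MatrixGroups Classical
open WithZero Finset
open Literature.NumberTheory.Automorphic Literature.NumberTheory.Automorphic.HermitianLattice Literature.NumberTheory.Automorphic.UnitaryLatticeTree
open Literature.NumberTheory.Automorphic.UnitaryThreeFourFrame (IsRamifiedQuadraticDatum normSign)
open Literature.NumberTheory.LocalFields.WildQuadraticDatum (normSign_mul_eq_neg_of_not_norm)
open Literature.NumberTheory.Rogawski1990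
open Summit.HodgeConjecture.HodgeConjecture.Cruxes.H413.F0P3cDyRamFourFramePieces
open Summit.HodgeConjecture.HodgeConjecture.Cruxes.H413.F0P3cDyRamFourFrameCensusDefs (LatticeInLevel LatticeNearTransvShell)
open Summit.HodgeConjecture.HodgeConjecture.Cruxes.H413.F0P3cDyRamStageOneBDefs (mcOfRecord)
open Summit.HodgeConjecture.HodgeConjecture.Cruxes.H413.F0P3cDyRamToricCensusDefs
open Summit.HodgeConjecture.HodgeConjecture.Cruxes.H413.F0P3cDyRamRowCellOnShell (uniformizer_letters)
open Summit.HodgeConjecture.HodgeConjecture.Cruxes.H413.F0P3cDyRamTopCellLawFrames (topCell_law_hyper topCell_law_aniso)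
open Summit.HodgeConjecture.HodgeConjecture.Cruxes.H413.F0P3cDyRamRamKFrameClassLetters (deep_of_datum)
open Summit.HodgeConjecture.HodgeConjecture.Cruxes.H413.F0P3cDyRamCoreOfPerCellLaws (cellValue_of_perCellLaw)
open Summit.HodgeConjecture.HodgeConjecture.Cruxes.H413.F0P3cDyRamRowCellDigitClassSplit (classClause_iff_not_classClause classClause_or classClause_of_far)
open Summit.HodgeConjecture.HodgeConjecture.Cruxes.H413.F0P3cDyRamRowCellDigitShellDictionary (sphereClause_iff_v_eq_one_of_lt)
open Summit.HodgeConjecture.HodgeConjecture.Cruxes.H413.F0P3cDyRamTopSphereLabelSumVanishes (sum_normSign_affine_topSphere_eq_zero)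

variable {E M : Type} [Field E] [Valued E ℤᵐ⁰] [Field M] [Valued M ℤᵐ⁰]

/-! ## §0 The precision letters of the top cell in the top chart are exponent arithmetic -/

/-- **THE PRECISION LETTERS OF THE TOP CELL `(b + 2N, b)` AT A RESOLUTION `r := |ϖ|^n`, `2d − 1 ≤ n ≤ b`.**  In the top chart (`|ξ₀|·|jEϖ|^{jl} = |jEϖ|^{2b+d%2}`, i.e.
`|ξ₀| = exp 2N` for `2b + d%2 = m`, `jl = m + 2N`): `r·|ξ₀|·|jEϖ^{b+2N}(α − ρα)| = exp(−n − b)`, hence `hrfloor` (`n ≤ b`), `hrR` (`1 ≤ n`), `hr₀` at `r₀ := |jEϖ|^{2d−1}` and `hrtop`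
(`2d − 1 ≤ n`) — ★ F1b-top's ∕ ★ A2-TOP's four precision letters. [cite: Serre1979, Ch. IV §2 Prop. 6] [cite: Kottwitz1986BaseChangeUnits, §1 pp. 240–241] -/
theorem precisionLetters_topCell {σ : E →+* E} {ϖ : E} {d tE : ℕ} (hD : IsRamifiedQuadraticDatum σ ϖ d tE)
    (jE : E →+* M) (hjiso : ∀ a, Valued.v (jE a) = Valued.v a) {ρ : M →+* M} {α : M} (hU : Valued.v (α - ρ α) = 1)
    {m jl b N n : ℕ} (hbm : 2 * b + d % 2 = m) (hNjl : m + 2 * N = jl) (hn : 2 * d - 1 ≤ n) (hnb : n ≤ b)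
    {ξ₀ : M} (hξv : Valued.v ξ₀ * Valued.v (jE ϖ) ^ jl = Valued.v (jE ϖ) ^ (2 * b + d % 2)) :
    Valued.v (jE ϖ) ^ (2 * b) ≤ Valued.v ϖ ^ n * Valued.v ξ₀ * Valued.v (jE ϖ ^ (b + 2 * N) * (α - ρ α)) ∧
      Valued.v ϖ ^ n * Valued.v ξ₀ * Valued.v (jE ϖ ^ (b + 2 * N) * (α - ρ α)) < Valued.v (jE ϖ) ^ b ∧
      Valued.v ϖ ^ n * Valued.v ξ₀ * Valued.v (jE ϖ ^ (b + 2 * N) * (α - ρ α)) ≤ Valued.v (jE ϖ) ^ (2 * d - 1) * Valued.v (jE ϖ) ^ b ∧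
      Valued.v ϖ ^ n ≤ Valued.v ϖ ^ (2 * d - 1) := by
  obtain ⟨-, -, hϖ, -, -, hd1, -⟩ := id hD
  have hπn : ∀ n : ℕ, Valued.v (jE ϖ) ^ n = exp (-(n : ℤ)) := fun n => by rw [hjiso, hϖ, ← exp_nsmul, nsmul_eq_mul, mul_neg, mul_one]
  have hϖn : ∀ n : ℕ, Valued.v ϖ ^ n = exp (-(n : ℤ)) := fun n => by rw [hϖ, ← exp_nsmul, nsmul_eq_mul, mul_neg, mul_one]
  -- `|ξ₀| = exp 2N`
  have hξv' : Valued.v ξ₀ = exp (2 * (N : ℤ)) := by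
    have h1 : Valued.v ξ₀ * exp (-(jl : ℤ)) = exp (-((2 * b + d % 2 : ℕ) : ℤ)) := by rw [← hπn, ← hπn]; exact hξv
    calc Valued.v ξ₀ = Valued.v ξ₀ * exp (-(jl : ℤ)) * exp (jl : ℤ) := by rw [mul_assoc, ← exp_add, neg_add_cancel, exp_zero, mul_one]
      _ = exp (2 * (N : ℤ)) := by rw [h1, ← exp_add]; congr 1; push_cast; omega
  have hccv : Valued.v (jE ϖ ^ (b + 2 * N) * (α - ρ α)) = Valued.v (jE ϖ) ^ (b + 2 * N) := by
    rw [Valuation.map_mul, hU, mul_one, Valuation.map_pow]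
  have hprod : Valued.v ϖ ^ n * Valued.v ξ₀ * Valued.v (jE ϖ ^ (b + 2 * N) * (α - ρ α)) = exp (-((n + b : ℕ) : ℤ)) := by
    rw [hccv, hϖn, hξv', hπn, ← exp_add, ← exp_add]; congr 1; push_cast; omega
  refine ⟨?_, ?_, ?_, ?_⟩
  · rw [hprod, hπn, exp_le_exp]; omega
  · rw [hprod, hπn, exp_lt_exp]; omega
  · rw [hprod, ← pow_add, hπn, exp_le_exp]; omega
  · rw [hϖn, hϖn, exp_le_exp]; omega

/-! ## §1 HEAD — the top cell identity -/

/-- **HEAD — «THE TOP CELL IDENTITY» (K6 DESK WORD #22 A5; the A6 skeleton's `htop`).**  Two-frame letters of ‹CORE.v1›∕‹CORE-ODD.v1› BY NAME (★ A2-TOP's frame letters +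
`hηN`), the dyadic letter, the K6 floor at `N₀`, the row `2b + d%2 = m`, the window `1 ≤ N`, `m + 2N = jl`, the TOP chart («A1-top» v2's conjuncts, BOTH unit letters), a top
digit system `Rd` mod `|ϖ|^n` with `2d − 1 ≤ n ≤ b`, and the top DENSITY letters `hdensH : n_H(b+2N) = φ·#(Rd.filter LIT_H)`, `hdensA : N < d → n_A(b+2N) = φ·#(Rd.filter LIT_A)`.  THEN
`X_H(b + 2N) = if N < d then X_A(b + 2N) else 0` in ★ (P1) `coreWindow_of_insideWindow_and_topCell`'s `htop` bytes at `ϖE := jE ϖ`, `μ := lam − jE u₀₀`, the letters' set-builders.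
[cite: Kottwitz1986BaseChangeUnits, §1 pp. 240–241] [cite: LabesseLanglands1979, §2 (2.2) p. 9] [cite: Rogawski1990, §4.9 Prop. 4.9.1 (b) p. 55] [cite: Serre1979, Ch. V §3 Cor. 3; Ch. XV §2] -/
theorem topCell_identity [CompleteSpace E] [IsDiscreteValuationRing 𝒪[E]] [Finite 𝓀[E]] [CompleteSpace M] [Finite 𝓀[M]]
    (σ : E →+* E) (ϖ : E) (d tE : ℕ) (hD : IsRamifiedQuadraticDatum σ ϖ d tE)
    (jE : E →+* M) (ρ Θ : M →+* M) (α lam : M)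
    (hρρ : ∀ z, ρ (ρ z) = z) (hvρ : ∀ z, Valued.v (ρ z) = Valued.v z)
    (hjv : ∀ a, Valued.v (jE a) ≤ 1 ↔ Valued.v a ≤ 1) (hjfix : ∀ z : M, ρ z = z ↔ ∃ a, jE a = z) (hΘj : ∀ a, Θ (jE a) = jE (σ a))
    (hΘΘ : ∀ z, Θ (Θ z) = z) (hΘρ : ∀ z, Θ (ρ z) = ρ (Θ z)) (hvΘ : ∀ z, Valued.v (Θ z) = Valued.v z)
    (hα : ρ α ≠ α) (hα1 : Valued.v α ≤ 1) (hint : ∀ z : M, Valued.v z ≤ 1 → Valued.v ((z - ρ z) / (α - ρ α)) ≤ 1)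
    (hΘlam : Θ lam * lam = 1) (hvlam : Valued.v lam = 1) (hU : Valued.v (α - ρ α) = 1) (hτ : Valued.v (α - Θ α) < 1)
    (hσres : ∀ z : M, ρ z = z → Valued.v z ≤ 1 → Valued.v (Θ z - z) < 1)
    (hDM : IsRamifiedQuadraticDatum Θ (jE ϖ) d tE) (hjiso : ∀ a, Valued.v (jE a) = Valued.v a)
    (hq : Nat.card 𝓀[M] = Nat.card 𝓀[E] ^ 2) (hjpow : ∀ (t : E) (n : ℤ), Valued.v (jE t) = Valued.v (jE ϖ) ^ n ↔ Valued.v t = Valued.v ϖ ^ n)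
    (hϖmax : ∀ t : M, ρ t = t → Valued.v t < 1 → Valued.v t ≤ Valued.v (jE ϖ))
    (u : GL (Fin 1) E) (m jl : ℕ) (hm : Valued.v (lam - jE ((u : Matrix (Fin 1) (Fin 1) E) 0 0)) = WithZero.exp (-(m : ℤ)))
    (hjl : Valued.v ((lam - jE ((u : Matrix (Fin 1) (Fin 1) E) 0 0)) - ρ (lam - jE ((u : Matrix (Fin 1) (Fin 1) E) 0 0))) = WithZero.exp (-(jl : ℤ)))
    (hum : Valued.v (((u : Matrix (Fin 1) (Fin 1) E) 0 0) - 1) ≤ Valued.v (ϖ ^ mstarOfRecord d)) (h2 : ¬ IsUnit (2 : 𝒪[E]))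
    -- the HYPERBOLIC frame `(γ₂, φ, h, f)` in the identity frame (‹CORE.v1›'s `_hΓ _hφs … _hf _hfinLS`)
    (γ₂ : GL (Fin 2) E) (hΓ : endoGL (γ₂, u) ∈ unitaryGroupOfForm σ ((StdForm.antidiagonal 3).over E))
    (φ : (Fin 2 → E) →+ M) (h : M) (hφs : ∀ (c : E) (x : Fin 2 → E), φ (c • x) = jE c * φ x) (hφi : Function.Injective φ) (hφo : Function.Surjective φ)
    (hφγ : ∀ x, φ ((γ₂ : Matrix (Fin 2) (Fin 2) E).mulVec x) = lam * φ x)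
    (hform : ∀ x y, jE (pairing σ ((StdForm.antidiagonal 2).over E) x y) = h * Θ (φ x) * φ y + ρ (h * Θ (φ x) * φ y)) (hΘh : Θ h = h) (hh : h ≠ 0)
    (f : ℕ → ℕ → AddSubgroup M → ℕ) (hfinLS : ∀ j a, (levelSet ρ Θ α (jE ϖ) h j a).Finite)
    (hf : ∀ (b j : ℕ) (Λ : AddSubgroup M) (x₀ : M) (r : E), 1 ≤ b → x₀ ≠ 0 → (∀ x, x ∈ Λ ↔ ∃ z, IsOrd ρ α (jE ϖ ^ j) z ∧ x = x₀ * z) →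
      IsOrd ρ α (jE ϖ ^ j) (dualGen ρ Θ α (jE ϖ ^ j) h x₀) → ¬ IsOrd ρ α (jE ϖ ^ j) (dualGen ρ Θ α (jE ϖ ^ j) h x₀ / jE ϖ) → Valued.v (dualGen ρ Θ α (jE ϖ ^ j) h x₀) = Valued.v (jE ϖ) ^ b →
      (∀ b', (∀ x ∈ Λ, Valued.v (h * Θ x * b' + ρ (h * Θ x * b')) ≤ 1) → (lam - jE ((u : Matrix (Fin 1) (Fin 1) E) 0 0)) * b' ∈ Λ) → IsOrd ρ α (jE ϖ ^ j) lam →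
      jE r = glueUnit ρ Θ α (jE ϖ ^ j) h (jE ϖ) (jE (1 : E)) x₀ b →
      f b j Λ = Nat.card {x : 𝒪[E] ⧸ 𝓂[E] ^ (2 * b) // ∃ u' : 𝒪[E], Ideal.Quotient.mk (𝓂[E] ^ (2 * b)) u' = x ∧ Valued.v ((u' : E) * σ u' - r) ≤ Valued.v (ϖ ^ (2 * b))})
    -- the ANISOTROPIC frame `(P₁, dg, η, γA, φ′, h′, f′)` (‹CORE.v1›'s `P₁ dg η γ₁ _hA _hΓ' _hdg1 _hdgσ _hησ _hη1 _hηN …`; `γA` = its `γ₁`)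
    (P₁ : GL (Fin 3) E) (dg : Fin 2 → E) (η : E) (γA : GL (Fin 2) E)
    (hA : formCongr σ P₁ ((StdForm.antidiagonal 3).over E) =
      (!![(Matrix.diagonal dg) 0 0, 0, (Matrix.diagonal dg) 0 1; 0, η, 0; (Matrix.diagonal dg) 1 0, 0, (Matrix.diagonal dg) 1 1] : Matrix (Fin 3) (Fin 3) E))
    (hΓ' : P₁ * endoGL (γA, u) * P₁⁻¹ ∈ unitaryGroupOfForm σ ((StdForm.antidiagonal 3).over E))
    (hdg1 : ∀ i, Valued.v (dg i) = 1) (hdgσ : ∀ i, σ (dg i) = dg i) (hησ : σ η = η) (hη1 : Valued.v η = 1) (hηN : ¬ ∃ t : E, t * σ t = η)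
    (φ' : (Fin 2 → E) →+ M) (h' : M) (hφ's : ∀ (c : E) (x : Fin 2 → E), φ' (c • x) = jE c * φ' x) (hφ'i : Function.Injective φ') (hφ'o : Function.Surjective φ')
    (hφ'γ : ∀ x, φ' ((γA : Matrix (Fin 2) (Fin 2) E).mulVec x) = lam * φ' x)
    (hform' : ∀ x y, jE (pairing σ (Matrix.diagonal dg) x y) = h' * Θ (φ' x) * φ' y + ρ (h' * Θ (φ' x) * φ' y)) (hΘh' : Θ h' = h') (hh' : h' ≠ 0)
    (f' : ℕ → ℕ → AddSubgroup M → ℕ) (hfinLS' : ∀ j a, (levelSet ρ Θ α (jE ϖ) h' j a).Finite)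
    (hf' : ∀ (b j : ℕ) (Λ : AddSubgroup M) (x₀ : M) (r : E), 1 ≤ b → x₀ ≠ 0 → (∀ x, x ∈ Λ ↔ ∃ z, IsOrd ρ α (jE ϖ ^ j) z ∧ x = x₀ * z) →
      IsOrd ρ α (jE ϖ ^ j) (dualGen ρ Θ α (jE ϖ ^ j) h' x₀) → ¬ IsOrd ρ α (jE ϖ ^ j) (dualGen ρ Θ α (jE ϖ ^ j) h' x₀ / jE ϖ) → Valued.v (dualGen ρ Θ α (jE ϖ ^ j) h' x₀) = Valued.v (jE ϖ) ^ b →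
      (∀ b', (∀ x ∈ Λ, Valued.v (h' * Θ x * b' + ρ (h' * Θ x * b')) ≤ 1) → (lam - jE ((u : Matrix (Fin 1) (Fin 1) E) 0 0)) * b' ∈ Λ) → IsOrd ρ α (jE ϖ ^ j) lam →
      jE r = glueUnit ρ Θ α (jE ϖ ^ j) h' (jE ϖ) (jE η) x₀ b →
      f' b j Λ = Nat.card {x : 𝒪[E] ⧸ 𝓂[E] ^ (2 * b) // ∃ u' : 𝒪[E], Ideal.Quotient.mk (𝓂[E] ^ (2 * b)) u' = x ∧ Valued.v ((u' : E) * σ u' - r) ≤ Valued.v (ϖ ^ (2 * b))})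
    -- the K6 floor (‹CORE.v1›'s `_hNm _hu1N _hlam1` at the assembler's fence value `N₀`, and `4d ≤ N₀`)
    {N₀ : ℕ} (h4d : 4 * d ≤ N₀) (hN₀m : N₀ ≤ m)
    (hu1N : Valued.v (((u : Matrix (Fin 1) (Fin 1) E) 0 0) - 1) ≤ Valued.v (ϖ ^ N₀)) (hlam1 : Valued.v (lam - 1) ≤ Valued.v (jE ϖ ^ N₀))
    -- the live row (both parities) and its window
    (b : ℕ) (hbm : 2 * b + d % 2 = m) {N : ℕ} (hN1 : 1 ≤ N) (hNjl : m + 2 * N = jl)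
    -- the TOP chart («A1-top» v2's letters, both unit letters)
    {κ₀ ξ₀ : M} (hκ₀ : κ₀ + ρ κ₀ = 1) (hΘκ₀ : Θ κ₀ = κ₀) (hκ₀v : Valued.v κ₀ = 1) (hξ : ρ ξ₀ = -ξ₀) (hΘξ : Θ ξ₀ = ξ₀)
    (hξN : Valued.v ξ₀ = exp (2 * (N : ℤ))) (hξv : Valued.v ξ₀ * Valued.v (jE ϖ) ^ jl = Valued.v (jE ϖ) ^ (2 * b + d % 2))
    {μa μb R₀ γ₀ : E} (hμab : lam - jE ((u : Matrix (Fin 1) (Fin 1) E) 0 0) = jE μa + jE μb * α)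
    (hR₀ : jE R₀ = α * κ₀ + ρ (α * κ₀)) (hγ₀ : jE γ₀ = ξ₀ * (α - ρ α))
    {α₁ γ₁ : E} (hα₁σ : σ α₁ = α₁) (hα₁1 : Valued.v α₁ = 1) (hγ₁σ : σ γ₁ = γ₁) (hγ₁v : Valued.v γ₁ = 1)
    (hαγ : ∀ V : E, σ V = V → Valued.v V ≤ 1 → Valued.v (μa + μb * (R₀ + V * γ₀)) = Valued.v ϖ ^ (2 * b + d % 2) → Valued.v (α₁ + γ₁ * V) = 1)
    (hγα : ∀ V : E, σ V = V → Valued.v V ≤ 1 → Valued.v (α₁ + γ₁ * V) = 1 → Valued.v (μa + μb * (R₀ + V * γ₀)) = Valued.v ϖ ^ (2 * b + d % 2))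
    (haff : ∀ (T W f : E), σ T = T → Valued.v T = 1 → σ W = W → Valued.v W ≤ 1 → σ f = f →
      Valued.v ((μa + μb * R₀) * ((ϖ * σ ϖ) ^ b)⁻¹ + μb * γ₀ * ((ϖ * σ ϖ) ^ b)⁻¹ * W) = Valued.v ((μa + μb * R₀) * ((ϖ * σ ϖ) ^ b)⁻¹) →
      Valued.v (T * ((μa + μb * R₀) * ((ϖ * σ ϖ) ^ b)⁻¹ + μb * γ₀ * ((ϖ * σ ϖ) ^ b)⁻¹ * W) - f * ((ϖ - σ ϖ) * ((ϖ * σ ϖ) ^ ((d - d % 2) / 2))⁻¹)) ≤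
        Valued.v ϖ ^ mstarOfRecord d → normSign σ f = normSign σ T * normSign σ (α₁ + γ₁ * W))
    -- the top digit system, `2d − 1 ≤ n ≤ b`
    (Rd : Finset E) {n : ℕ} (hn : 2 * d - 1 ≤ n) (hnb : n ≤ b) (hRd1 : ∀ V ∈ Rd, σ V = V ∧ Valued.v V ≤ 1)
    (hRd2 : ∀ V : E, σ V = V → Valued.v V ≤ 1 → ∃ V₀ ∈ Rd, Valued.v (V - V₀) ≤ Valued.v ϖ ^ n)
    (hRd3 : ∀ V ∈ Rd, ∀ V' ∈ Rd, Valued.v (V - V') ≤ Valued.v ϖ ^ n → V = V')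
    -- the top DENSITY letters (LH4-p08 (g12)'s `topCell_density`, plugged by the assembler)
    {φd : ℤ}
    (hdensH : ((∑ᶠ Λ ∈ levelSetDep ρ Θ α (jE ϖ) h (b + 2 * N) b (lam - jE ((u : Matrix (Fin 1) (Fin 1) E) 0 0)), f b (b + 2 * N) Λ : ℕ) : ℤ) =
      φd * ((Rd.filter (fun V₀ : E => Valued.v (κ₀ + jE V₀ * ξ₀) * Valued.v (jE ϖ ^ (b + 2 * N) * (α - ρ α)) = Valued.v (jE ϖ) ^ b ∧
        ∃ e : M, ρ e = e ∧ e * Θ e = (κ₀ + jE V₀ * ξ₀) * ρ (κ₀ + jE V₀ * ξ₀) / (h * ρ h))).card : ℤ))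
    (hdensA : N < d → ((∑ᶠ Λ ∈ levelSetDep ρ Θ α (jE ϖ) h' (b + 2 * N) b (lam - jE ((u : Matrix (Fin 1) (Fin 1) E) 0 0)), f' b (b + 2 * N) Λ : ℕ) : ℤ) =
      φd * ((Rd.filter (fun V₀ : E => Valued.v (κ₀ + jE V₀ * ξ₀) * Valued.v (jE ϖ ^ (b + 2 * N) * (α - ρ α)) = Valued.v (jE ϖ) ^ b ∧
        ∃ e : M, ρ e = e ∧ e * Θ e = (κ₀ + jE V₀ * ξ₀) * ρ (κ₀ + jE V₀ * ξ₀) / (h' * ρ h'))).card : ℤ)) :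
    (((∑ᶠ Λ ∈ levelSetDep ρ Θ α (jE ϖ) h (b + 2 * N) b (lam - jE ((u : Matrix (Fin 1) (Fin 1) E) 0 0)) ∩
          {Λ | ∃ B : Submodule 𝒪[E] (Fin 2 → E), B.toAddSubgroup.map φ = Λ ∧
            ∃ L₃ : Submodule 𝒪[E] (Fin 3 → E), IsSelfDualLattice σ ϖ (!![((StdForm.antidiagonal 2).over E) 0 0, 0, ((StdForm.antidiagonal 2).over E) 0 1; 0, (1 : E), 0; ((StdForm.antidiagonal 2).over E) 1 0, 0, ((StdForm.antidiagonal 2).over E) 1 1] : Matrix (Fin 3) (Fin 3) E) L₃ ∧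
              L₃ ⊓ LinearMap.ker ((LinearMap.proj (1 : Fin 3) : (Fin 3 → E) →ₗ[E] E).restrictScalars 𝒪[E]) =
                B.map ((Matrix.toLin' (!![1, 0; 0, 0; 0, 1] : Matrix (Fin 3) (Fin 2) E)).restrictScalars 𝒪[E]) ∧
              (∀ c : E, (Pi.single 1 c : Fin 3 → E) ∈ L₃ ↔ Valued.v c ≤ Valued.v ϖ ^ b) ∧
              (LatticeNearTransvShell ϖ (d % 2) (mstarOfRecord d) ((((endoGL (γ₂, u) : GL (Fin 3) E) : Matrix (Fin 3) (Fin 3) E) - 1)) L₃ ∧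
                {z : E | ∃ y ∈ L₃, Valued.v ((ϖ ^ (mstarOfRecord d))⁻¹ * (z - pairing σ (!![((StdForm.antidiagonal 2).over E) 0 0, 0, ((StdForm.antidiagonal 2).over E) 0 1; 0, (1 : E), 0; ((StdForm.antidiagonal 2).over E) 1 0, 0, ((StdForm.antidiagonal 2).over E) 1 1] : Matrix (Fin 3) (Fin 3) E) y (((((endoGL (γ₂, u) : GL (Fin 3) E) : Matrix (Fin 3) (Fin 3) E) - 1)) *ᵥ y))) ≤ 1} =
                  valueSetMod σ ϖ (mstarOfRecord d) (xPlus σ ϖ d))}, f b (b + 2 * N) Λ : ℕ) : ℤ) -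
        ((∑ᶠ Λ ∈ levelSetDep ρ Θ α (jE ϖ) h (b + 2 * N) b (lam - jE ((u : Matrix (Fin 1) (Fin 1) E) 0 0)) ∩
          {Λ | ∃ B : Submodule 𝒪[E] (Fin 2 → E), B.toAddSubgroup.map φ = Λ ∧
            ∃ L₃ : Submodule 𝒪[E] (Fin 3 → E), IsSelfDualLattice σ ϖ (!![((StdForm.antidiagonal 2).over E) 0 0, 0, ((StdForm.antidiagonal 2).over E) 0 1; 0, (1 : E), 0; ((StdForm.antidiagonal 2).over E) 1 0, 0, ((StdForm.antidiagonal 2).over E) 1 1] : Matrix (Fin 3) (Fin 3) E) L₃ ∧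
              L₃ ⊓ LinearMap.ker ((LinearMap.proj (1 : Fin 3) : (Fin 3 → E) →ₗ[E] E).restrictScalars 𝒪[E]) =
                B.map ((Matrix.toLin' (!![1, 0; 0, 0; 0, 1] : Matrix (Fin 3) (Fin 2) E)).restrictScalars 𝒪[E]) ∧
              (∀ c : E, (Pi.single 1 c : Fin 3 → E) ∈ L₃ ↔ Valued.v c ≤ Valued.v ϖ ^ b) ∧
              (LatticeNearTransvShell ϖ (d % 2) (mcOfRecord d) ((((endoGL (γ₂, u) : GL (Fin 3) E) : Matrix (Fin 3) (Fin 3) E) - 1)) L₃ ∧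
                ¬ {z : E | ∃ y ∈ L₃, Valued.v ((ϖ ^ (mstarOfRecord d))⁻¹ * (z - pairing σ (!![((StdForm.antidiagonal 2).over E) 0 0, 0, ((StdForm.antidiagonal 2).over E) 0 1; 0, (1 : E), 0; ((StdForm.antidiagonal 2).over E) 1 0, 0, ((StdForm.antidiagonal 2).over E) 1 1] : Matrix (Fin 3) (Fin 3) E) y (((((endoGL (γ₂, u) : GL (Fin 3) E) : Matrix (Fin 3) (Fin 3) E) - 1)) *ᵥ y))) ≤ 1} =
                  valueSetMod σ ϖ (mstarOfRecord d) (xPlus σ ϖ d))}, f b (b + 2 * N) Λ : ℕ) : ℤ)) =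
      if N < d then
        (((∑ᶠ Λ ∈ levelSetDep ρ Θ α (jE ϖ) h' (b + 2 * N) b (lam - jE ((u : Matrix (Fin 1) (Fin 1) E) 0 0)) ∩
          {Λ | ∃ B : Submodule 𝒪[E] (Fin 2 → E), B.toAddSubgroup.map φ' = Λ ∧
            ∃ L₃ : Submodule 𝒪[E] (Fin 3 → E), IsSelfDualLattice σ ϖ (!![(Matrix.diagonal dg) 0 0, 0, (Matrix.diagonal dg) 0 1; 0, η, 0; (Matrix.diagonal dg) 1 0, 0, (Matrix.diagonal dg) 1 1] : Matrix (Fin 3) (Fin 3) E) L₃ ∧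
              L₃ ⊓ LinearMap.ker ((LinearMap.proj (1 : Fin 3) : (Fin 3 → E) →ₗ[E] E).restrictScalars 𝒪[E]) =
                B.map ((Matrix.toLin' (!![1, 0; 0, 0; 0, 1] : Matrix (Fin 3) (Fin 2) E)).restrictScalars 𝒪[E]) ∧
              (∀ c : E, (Pi.single 1 c : Fin 3 → E) ∈ L₃ ↔ Valued.v c ≤ Valued.v ϖ ^ b) ∧
              (LatticeNearTransvShell ϖ (d % 2) (mstarOfRecord d) ((((endoGL (γA, u) : GL (Fin 3) E) : Matrix (Fin 3) (Fin 3) E) - 1)) L₃ ∧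
                {z : E | ∃ y ∈ L₃, Valued.v ((ϖ ^ (mstarOfRecord d))⁻¹ * (z - pairing σ (!![(Matrix.diagonal dg) 0 0, 0, (Matrix.diagonal dg) 0 1; 0, η, 0; (Matrix.diagonal dg) 1 0, 0, (Matrix.diagonal dg) 1 1] : Matrix (Fin 3) (Fin 3) E) y (((((endoGL (γA, u) : GL (Fin 3) E) : Matrix (Fin 3) (Fin 3) E) - 1)) *ᵥ y))) ≤ 1} =
                  valueSetMod σ ϖ (mstarOfRecord d) (xPlus σ ϖ d))}, f' b (b + 2 * N) Λ : ℕ) : ℤ) -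
        ((∑ᶠ Λ ∈ levelSetDep ρ Θ α (jE ϖ) h' (b + 2 * N) b (lam - jE ((u : Matrix (Fin 1) (Fin 1) E) 0 0)) ∩
          {Λ | ∃ B : Submodule 𝒪[E] (Fin 2 → E), B.toAddSubgroup.map φ' = Λ ∧
            ∃ L₃ : Submodule 𝒪[E] (Fin 3 → E), IsSelfDualLattice σ ϖ (!![(Matrix.diagonal dg) 0 0, 0, (Matrix.diagonal dg) 0 1; 0, η, 0; (Matrix.diagonal dg) 1 0, 0, (Matrix.diagonal dg) 1 1] : Matrix (Fin 3) (Fin 3) E) L₃ ∧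
              L₃ ⊓ LinearMap.ker ((LinearMap.proj (1 : Fin 3) : (Fin 3 → E) →ₗ[E] E).restrictScalars 𝒪[E]) =
                B.map ((Matrix.toLin' (!![1, 0; 0, 0; 0, 1] : Matrix (Fin 3) (Fin 2) E)).restrictScalars 𝒪[E]) ∧
              (∀ c : E, (Pi.single 1 c : Fin 3 → E) ∈ L₃ ↔ Valued.v c ≤ Valued.v ϖ ^ b) ∧
              (LatticeNearTransvShell ϖ (d % 2) (mcOfRecord d) ((((endoGL (γA, u) : GL (Fin 3) E) : Matrix (Fin 3) (Fin 3) E) - 1)) L₃ ∧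
                ¬ {z : E | ∃ y ∈ L₃, Valued.v ((ϖ ^ (mstarOfRecord d))⁻¹ * (z - pairing σ (!![(Matrix.diagonal dg) 0 0, 0, (Matrix.diagonal dg) 0 1; 0, η, 0; (Matrix.diagonal dg) 1 0, 0, (Matrix.diagonal dg) 1 1] : Matrix (Fin 3) (Fin 3) E) y (((((endoGL (γA, u) : GL (Fin 3) E) : Matrix (Fin 3) (Fin 3) E) - 1)) *ᵥ y))) ≤ 1} =
                  valueSetMod σ ϖ (mstarOfRecord d) (xPlus σ ϖ d))}, f' b (b + 2 * N) Λ : ℕ) : ℤ))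
      else 0 := by
  classical
  obtain ⟨-, -, hϖ, -, -, hd1, -⟩ := id hD
  obtain ⟨-, hϖlt, hjϖ0, -, -, -, -⟩ := uniformizer_letters jE hjv hϖ
  have h2v : Valued.v (2 : E) < 1 := by exact_mod_cast Valuation.Integer.not_isUnit_iff_valuation_lt_one.mp h2
  have hπn : ∀ n : ℕ, Valued.v (jE ϖ) ^ n = exp (-(n : ℤ)) := fun n => by rw [hjiso, hϖ, ← exp_nsmul, nsmul_eq_mul, mul_neg, mul_one]
  -- the two top laws (★ A2-TOP), one per frame, with the precision letters of §0 and `hdeep` at `r₀ := |jEϖ|^{2d−1}`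
  obtain ⟨hrfloor, hrR, hr₀, hrtop⟩ := precisionLetters_topCell hD jE hjiso hU hbm hNjl hn hnb hξv
  have hdeep : ∀ w : M, ρ w = w → Θ w = w → Valued.v (w - 1) ≤ Valued.v (jE ϖ) ^ (2 * d - 1) → ∃ c : M, ρ c = c ∧ c * Θ c = w :=
    deep_of_datum hD jE hjv hjfix hΘj le_rfl
  have hRdσ : ∀ V ∈ Rd, σ V = V := fun V hV => (hRd1 V hV).1
  have lawH := topCell_law_hyper σ ϖ d tE hD jE ρ Θ α lam hρρ hvρ hjv hjfix hΘj hΘΘ hΘρ hvΘ hα hα1 hint hΘlam hvlam hU hτ hσres hDM hjiso hq hjpow hϖmax γ₂ u m jl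
    hm hjl hum hΓ φ h hφs hφi hφo hφγ hform hΘh hh f hf hfinLS h4d hN₀m hu1N hlam1 b hbm h2 hN1 hNjl hκ₀ hΘκ₀ hκ₀v.le hξ hΘξ hξv hμab hR₀ hγ₀ hα₁σ hγ₁σ hγ₁v.le
    hαγ haff Rd hRdσ hRd2 hRd3 hrfloor hrR hr₀ hdeep hrtop
  -- the solved value of the hyperbolic top cell (★ §3 with the density letter)
  have hXH := cellValue_of_perCellLaw ρ Θ α (jE ϖ) h (lam - jE ((u : Matrix (Fin 1) (Fin 1) E) 0 0)) f (b + 2 * N) b _ _ (hfinLS (b + 2 * N) b) _ _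
    (Finset.filter_subset _ _) (fun V => normSign σ (α₁ + γ₁ * V)) (normSign σ (-(1 : E))) φd lawH hdensH
  -- the digit line: sphere clause = `|V| = 1`, `NX ↔ unit label`
  have hlt : Valued.v κ₀ < Valued.v ξ₀ := by rw [hκ₀v, hξN, ← exp_zero]; exact exp_lt_exp.2 (by omega)
  have hcc : jE ϖ ^ (b + 2 * N) * (α - ρ α) ≠ 0 := mul_ne_zero (pow_ne_zero _ hjϖ0) (sub_ne_zero.2 (Ne.symm hα))
  have hξR : Valued.v ξ₀ * Valued.v (jE ϖ ^ (b + 2 * N) * (α - ρ α)) = Valued.v (jE ϖ) ^ b := by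
    rw [Valuation.map_mul, hU, mul_one, Valuation.map_pow, hξN, hπn, hπn, ← exp_add]; congr 1; push_cast; omega
  have hsph : ∀ V ∈ Rd, (Valued.v (κ₀ + jE V * ξ₀) * Valued.v (jE ϖ ^ (b + 2 * N) * (α - ρ α)) = Valued.v (jE ϖ) ^ b ↔ Valued.v V = 1) :=
    fun V hV => sphereClause_iff_v_eq_one_of_lt jE hjiso hcc hlt hξR (hRd1 V hV).2
  have hNX : ∀ V ∈ Rd, (Valued.v (μa + μb * (R₀ + V * γ₀)) = Valued.v ϖ ^ (2 * b + d % 2) ↔ Valued.v (α₁ + γ₁ * V) = 1) :=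
    fun V hV => ⟨hαγ V (hRd1 V hV).1 (hRd1 V hV).2, hγα V (hRd1 V hV).1 (hRd1 V hV).2⟩
  -- ★ (g-top): the top-sphere label sum vanishes
  have hgtop := sum_normSign_affine_topSphere_eq_zero hD h2v hα₁σ hα₁1 hγ₁σ hγ₁v hn Rd hRd1 hRd2 hRd3
  by_cases hNd : N < d
  · rw [if_pos hNd]
    have lawA := topCell_law_aniso σ ϖ d tE hD jE ρ Θ α lam hρρ hvρ hjv hjfix hΘj hΘΘ hΘρ hvΘ hα hα1 hint hΘlam hvlam hU hτ hσres hDM hjiso hq hjpow hϖmax u m jl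
      hm hjl hum P₁ dg η γA hA hΓ' hdg1 hdgσ hησ hη1 φ' h' hφ's hφ'i hφ'o hφ'γ hform' hΘh' hh' f' hf' hfinLS' h4d hN₀m hu1N hlam1 b hbm h2 hN1 hNjl hκ₀ hΘκ₀ hκ₀v.le
      hξ hΘξ hξv hμab hR₀ hγ₀ hα₁σ hγ₁σ hγ₁v.le hαγ haff Rd hRdσ hRd2 hRd3 hrfloor hrR hr₀ hdeep hrtop
    have hXA := cellValue_of_perCellLaw ρ Θ α (jE ϖ) h' (lam - jE ((u : Matrix (Fin 1) (Fin 1) E) 0 0)) f' (b + 2 * N) b _ _ (hfinLS' (b + 2 * N) b) _ _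
      (Finset.filter_subset _ _) (fun V => normSign σ (α₁ + γ₁ * V)) (normSign σ (-η)) φd lawA (hdensA hNd)
    -- the sign letter `ω(−η) = −ω(−1)`
    have hsgn : normSign σ (-η) = -normSign σ (-(1 : E)) := by
      have h1 := normSign_mul_eq_neg_of_not_norm hD hησ hηN (g := -(1 : E)) (by rw [map_neg, map_one]) (neg_ne_zero.2 one_ne_zero)
      rwa [mul_neg_one] at h1
    -- the class split of the unit-label sphere: `S′_H ⊔ S′_A` = (g-top)'s sphere
    have hunion : ((Rd.filter (fun V₀ : E => Valued.v (κ₀ + jE V₀ * ξ₀) * Valued.v (jE ϖ ^ (b + 2 * N) * (α - ρ α)) = Valued.v (jE ϖ) ^ b ∧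
        ∃ e : M, ρ e = e ∧ e * Θ e = (κ₀ + jE V₀ * ξ₀) * ρ (κ₀ + jE V₀ * ξ₀) / (h * ρ h))).filter
          (fun V => Valued.v (μa + μb * (R₀ + V * γ₀)) = Valued.v ϖ ^ (2 * b + d % 2))) ∪
        ((Rd.filter (fun V₀ : E => Valued.v (κ₀ + jE V₀ * ξ₀) * Valued.v (jE ϖ ^ (b + 2 * N) * (α - ρ α)) = Valued.v (jE ϖ) ^ b ∧
        ∃ e : M, ρ e = e ∧ e * Θ e = (κ₀ + jE V₀ * ξ₀) * ρ (κ₀ + jE V₀ * ξ₀) / (h' * ρ h'))).filter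
          (fun V => Valued.v (μa + μb * (R₀ + V * γ₀)) = Valued.v ϖ ^ (2 * b + d % 2))) =
        Rd.filter (fun V => Valued.v V = 1 ∧ Valued.v (α₁ + γ₁ * V) = 1) := by
      ext V
      simp only [Finset.mem_union, Finset.mem_filter]
      constructor
      · rintro (⟨⟨hV, hS, -⟩, hX⟩ | ⟨⟨hV, hS, -⟩, hX⟩)
        · exact ⟨hV, (hsph V hV).1 hS, (hNX V hV).1 hX⟩
        · exact ⟨hV, (hsph V hV).1 hS, (hNX V hV).1 hX⟩
      · rintro ⟨hV, hV1, hU1⟩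
        have hS := (hsph V hV).2 hV1
        have hX := (hNX V hV).2 hU1
        rcases classClause_or hD jE hjfix hΘj hρρ hΘρ P₁ dg η hA hηN φ hform hΘh hh φ' hform' hΘh' hh' hκ₀ hΘκ₀ hξ hΘξ (hRd1 V hV).1 with hcl | hcl
        · exact Or.inl ⟨⟨hV, hS, hcl⟩, hX⟩
        · exact Or.inr ⟨⟨hV, hS, hcl⟩, hX⟩
    have hdisj : Disjoint
        ((Rd.filter (fun V₀ : E => Valued.v (κ₀ + jE V₀ * ξ₀) * Valued.v (jE ϖ ^ (b + 2 * N) * (α - ρ α)) = Valued.v (jE ϖ) ^ b ∧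
        ∃ e : M, ρ e = e ∧ e * Θ e = (κ₀ + jE V₀ * ξ₀) * ρ (κ₀ + jE V₀ * ξ₀) / (h * ρ h))).filter
          (fun V => Valued.v (μa + μb * (R₀ + V * γ₀)) = Valued.v ϖ ^ (2 * b + d % 2)))
        ((Rd.filter (fun V₀ : E => Valued.v (κ₀ + jE V₀ * ξ₀) * Valued.v (jE ϖ ^ (b + 2 * N) * (α - ρ α)) = Valued.v (jE ϖ) ^ b ∧
        ∃ e : M, ρ e = e ∧ e * Θ e = (κ₀ + jE V₀ * ξ₀) * ρ (κ₀ + jE V₀ * ξ₀) / (h' * ρ h'))).filter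
          (fun V => Valued.v (μa + μb * (R₀ + V * γ₀)) = Valued.v ϖ ^ (2 * b + d % 2))) := by
      rw [Finset.disjoint_left]
      intro V hVH hVA
      simp only [Finset.mem_filter] at hVH hVA
      exact (classClause_iff_not_classClause hD jE hjfix hΘj hρρ hΘρ P₁ dg η hA hηN φ hform hΘh hh φ' hform' hΘh' hh' hκ₀ hΘκ₀ hξ hΘξ
        (hRd1 V hVH.1.1).1).1 hVA.1.2.2 hVH.1.2.2
    have hsum := Finset.sum_union hdisj (f := fun V => normSign σ (α₁ + γ₁ * V))
    rw [hunion, hgtop] at hsum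
    rw [hXH, hXA, hsgn]
    linear_combination (-(φd * normSign σ (-(1 : E)))) * hsum
  · rw [if_neg hNd]
    -- far top sphere: ONE-class hyperbolic, so `S′_H` = (g-top)'s sphere
    have hfar : ∀ V ∈ Rd, Valued.v V = 1 →
        ∃ e : M, ρ e = e ∧ e * Θ e = (κ₀ + jE V * ξ₀) * ρ (κ₀ + jE V * ξ₀) / (h * ρ h) := by
      intro V hV hV1
      refine classClause_of_far hD jE hjfix hΘj hjiso hρρ hvρ hΘρ φ hform hΘκ₀ hκ₀v hξ hΘξ (hRd1 V hV).1 ?_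
      rw [hV1, one_mul, hξN]; exact exp_le_exp.2 (by omega)
    have heq : ((Rd.filter (fun V₀ : E => Valued.v (κ₀ + jE V₀ * ξ₀) * Valued.v (jE ϖ ^ (b + 2 * N) * (α - ρ α)) = Valued.v (jE ϖ) ^ b ∧
        ∃ e : M, ρ e = e ∧ e * Θ e = (κ₀ + jE V₀ * ξ₀) * ρ (κ₀ + jE V₀ * ξ₀) / (h * ρ h))).filter
          (fun V => Valued.v (μa + μb * (R₀ + V * γ₀)) = Valued.v ϖ ^ (2 * b + d % 2))) =
        Rd.filter (fun V => Valued.v V = 1 ∧ Valued.v (α₁ + γ₁ * V) = 1) := by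
      ext V
      simp only [Finset.mem_filter]
      constructor
      · rintro ⟨⟨hV, hS, -⟩, hX⟩
        exact ⟨hV, (hsph V hV).1 hS, (hNX V hV).1 hX⟩
      · rintro ⟨hV, hV1, hU1⟩
        exact ⟨⟨hV, (hsph V hV).2 hV1, hfar V hV hV1⟩, (hNX V hV).2 hU1⟩
    rw [hXH, heq, hgtop, mul_zero]

end Summit.HodgeConjecture.HodgeConjecture.Cruxes.H413.F0P3cDyRamTopCellIdentity

end
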